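import Mathlib
import HarnessLib
import Summits.NavierStokesRegularity.NavierStokesRegularity.Theorems.PoloidalWindowDoorLrcModEntireUntwistedNormalForm
import Summits.NavierStokesRegularity.NavierStokesRegularity.Theorems.PoloidalWindowDoorPoloidalWindowRigidityUntwistedDynamicsAnalytic
import Summits.NavierStokesRegularity.NavierStokesRegularity.Theorems.PoloidalWindowDoorPoloidalWindowRigidityUntwistedStuartTranslation3

/-!
# Route `PoloidalWindowDoor`, item `LrcModEntire` (stmt-NavierStokesRegularity-20428), skeleton `twist-split` — THE UNTWISTED STUB
# `stub_untwistedGerm` PROVED: a non-degenerate UNTWISTED poloidal class profile carries a Killing germ of its vorticity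

Cell ns-regularity-ideate, seat ns-poloidal-K2-p3 (gen 6, LEAD of item 20428; file landed `--supports stmt-NavierStokesRegularity-20428`, proving the
REGISTERED stub `stub_untwistedGerm` of `Cruxes/LrcModEntire/Lines/twist_split.lean` BY NAME AND SIGNATURE).  Paper proof: the K2 lead's
`Cruxes/PoloidalWindowRigidity/UNTWISTED-NOTE.md` §3 (ns-poloidal-K2-p1 g6).  This is the closing line of a multi-seat Lean chain:

* F2 — the untwisted NORMAL FORM for class profiles (ns-poloidal-K2-p2 g5: `…StructureFunctionDynamics` p554131, `…StructureFunctionNormalForm`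
  p555299, `…UntwistedDynamics` p557324, `…UntwistedDynamicsAnalytic.untwisted_normalForm_analytic` p559247): near every point of a non-degenerate
  untwisted window, analytic structure functions `P, Λ, k, p_t` with `∂₂v₂ = P(v₂,y₂)`, `∂₂v_b = Λ ∂_b v₂`, `Λ ∉ {0,1}`, the divergence identity (K1),
  the dynamic identity (V0) and the transport rule for `S = vₕ·∇ₕv₂ + ∂ₜv₂`;
* F3/F4 — SEPARATION OF VARIABLES in the height and the empty Stuart branch (K2 lead: `…UntwistedSeparation{,2}` p548007/p548501,
  `…UntwistedStuartBranch` p549904, `…UntwistedStuartTranslation{,2,3,Analytic}`, `branch2b_false` p556680);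
* F1/F5 and the glue — this seat: `…UntwistedKinematics` p550415, `…UntwistedSliceGlue` p548451 (g5), `…UntwistedIsoparametric{,Class}`
  p552515/p553079 (planar Levi-Civita–Segre on one slice + vertical propagation ⇒ rotation/translation germ of `v₂` ⇒ Clebsch germ ⇒ vorticity germ),
  `…UntwistedLeafRegularity` p555204, `…UntwistedLeafwiseGerm` p556034, and the dichotomy `…LrcModEntireUntwistedNormalForm` p557241.

* `stub_untwistedGerm` — **class + poloidal along `e₃` + nonempty open non-degenerate `W` in the backward slab + twist bracket `{∂₂v₂, v₂}ₕ ≡ 0` on `W`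
  ⇒ some slice carries, on a nonempty open set, a translation germ of the vorticity, a rotation germ about a vertical axis, or the entire leg.**
  Proof: pick `(t, y₀) ∈ W`; F2 gives the normal form on an open `U ∋ y₀`; the dichotomy gives the germ or the Stuart-branch data; the latter is
  contradictory by `branch2b_false`.  (Inside the class the germ forces `v ≡ 0` — `…LrcModEntireIff.eq_zero_of_germ` — contradicting non-degeneracy, so
  the honest content is «untwisted non-degenerate poloidal class profiles do not exist»; the K2 lead's `stub_untwisted` of 19708 follows by
  `stub_untwisted_of_germStub` of the twist-split skeleton, see the sequel file.)

WHAT THIS IS NOT: not a claim about Navier–Stokes regularity and not the item `LrcModEntire` (whose twisting stubs `stub_twistingTH` /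
`stub_twistingThick` remain the research residue) — ONE registered stub of its skeleton, kernel-checked (bears_on LADDER-NS N0 via items 20428 / 19708).
-/

noncomputable section

-- the summit and its single sub-problem share the name (CONVENTIONS §1), as in every Theorems file
set_option linter.dupNamespace false

namespace Summit.NavierStokesRegularity.NavierStokesRegularity.Theorems.PoloidalWindowDoorLrcModEntireUntwistedGerm

open Set Function Filter Topology Metric
open scoped RealInnerProductSpace InnerProductSpace ContDiff
open Literature.Analysis Literature.Analysis.FluidPDE
open Summit.NavierStokesRegularity.NavierStokesRegularity.Theorems.LocalSineTubeDoorProfileAlignedWindowRigidityAncient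
open Summit.NavierStokesRegularity.NavierStokesRegularity.Theorems.PoloidalWindowDoorPoloidalWindowRigidityConstantShearMeans
open Summit.NavierStokesRegularity.NavierStokesRegularity.Theorems.PoloidalWindowDoorLrcModEntireUntwistedNormalForm
open Summit.NavierStokesRegularity.NavierStokesRegularity.Theorems.PoloidalWindowDoorPoloidalWindowRigidityUntwistedDynamicsAnalytic
open Summit.NavierStokesRegularity.NavierStokesRegularity.Theorems.PoloidalWindowDoorPoloidalWindowRigidityUntwistedStuartTranslation3

/-- **STUB `stub_untwistedGerm` OF THE TWIST-SPLIT SKELETON OF `LrcModEntire` (stmt-NavierStokesRegularity-20428), PROVED.**  For a profile of the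
route's Type-I class, poloidal along `e₃`: on a nonempty open space–time subset `W` of the backward slab on which the profile is non-degenerate
(`curl v ≠ 0`, `∇ₕv₂ ≠ 0`, `∂₂vₕ ≠ 0` pointwise) and the twist bracket `∂₀(∂₂v₂)·∂₁v₂ − ∂₁(∂₂v₂)·∂₀v₂` vanishes pointwise, some slice `s < 0` carries on
a nonempty open `U` a translation germ of the vorticity, or a rotation germ about a vertical axis, or `v(s)` agrees on `U` with an entire real-analytic
field unbounded on `ℝ³` (UNTWISTED-NOTE §3: normal form ⇒ separation of variables ⇒ isoparametric leaves or the empty Stuart branch ⇒ Segre ⇒ germ).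
[folklore] -/
theorem stub_untwistedGerm :

    ∀ (C : ℝ) (v : ℝ → EuclideanSpace ℝ (Fin 3) → EuclideanSpace ℝ (Fin 3)),
      Literature.Analysis.FluidPDE.HasTypeITimeDecay C v →
      ContinuousOn (Function.uncurry v) (Set.Iio (0 : ℝ) ×ˢ Set.univ) →
      (∀ s t : ℝ, s < t → t < 0 → ∀ x, v t x =
        Literature.Analysis.UnboundedOperators.heatExtension (v s) (t - s) x -
          Literature.Analysis.FluidPDE.oseenDuhamel 1 s v v t x) →
      (∀ t < 0, Literature.Analysis.FluidPDE.VectorCalculus.IsDivFree (v t)) →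
      (∀ s < 0, ∀ y, ⟪Literature.Analysis.FluidPDE.curl (v s) y, EuclideanSpace.single 2 1⟫_ℝ = 0) →
      ∀ W : Set (ℝ × EuclideanSpace ℝ (Fin 3)), IsOpen W → W.Nonempty → W ⊆ Set.Iio (0 : ℝ) ×ˢ Set.univ →
        (∀ z ∈ W, Literature.Analysis.FluidPDE.curl (v z.1) z.2 ≠ 0 ∧
          (fderiv ℝ (v z.1) z.2 (EuclideanSpace.single 0 1) 2 ≠ 0 ∨ fderiv ℝ (v z.1) z.2 (EuclideanSpace.single 1 1) 2 ≠ 0) ∧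
          (fderiv ℝ (v z.1) z.2 (EuclideanSpace.single 2 1) 0 ≠ 0 ∨ fderiv ℝ (v z.1) z.2 (EuclideanSpace.single 2 1) 1 ≠ 0)) →
        (∀ z ∈ W,
          fderiv ℝ (fun x => fderiv ℝ (v z.1) x (EuclideanSpace.single 2 1) 2) z.2 (EuclideanSpace.single 0 1) *
              fderiv ℝ (v z.1) z.2 (EuclideanSpace.single 1 1) 2 -
            fderiv ℝ (fun x => fderiv ℝ (v z.1) x (EuclideanSpace.single 2 1) 2) z.2 (EuclideanSpace.single 1 1) *
              fderiv ℝ (v z.1) z.2 (EuclideanSpace.single 0 1) 2 = 0) →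
        ∃ s : ℝ, s < 0 ∧ ∃ U : Set (EuclideanSpace ℝ (Fin 3)), IsOpen U ∧ U.Nonempty ∧
          ((∃ e : EuclideanSpace ℝ (Fin 3), e ≠ 0 ∧
              ∀ y ∈ U, fderiv ℝ (Literature.Analysis.FluidPDE.curl (v s)) y e = 0) ∨
           (∃ c : EuclideanSpace ℝ (Fin 3), ∀ y ∈ U,
              Literature.Analysis.FluidPDE.rotGen (Literature.Analysis.FluidPDE.curl (v s) y) =
                fderiv ℝ (Literature.Analysis.FluidPDE.curl (v s)) y (Literature.Analysis.FluidPDE.rotGen (y - c))) ∨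
           (∃ w : EuclideanSpace ℝ (Fin 3) → EuclideanSpace ℝ (Fin 3), AnalyticOnNhd ℝ w Set.univ ∧
              ¬ BddAbove (Set.range fun y => ‖w y‖) ∧ ∀ y ∈ U, v s y = w y)) := by
  intro C v hrate hcont hmild hdiv hpol W hW hWne hWs hnd htw
  obtain ⟨z₀, hz₀⟩ := hWne
  obtain ⟨t, y₀⟩ := z₀
  have ht : t < 0 := (Set.mem_prod.1 (hWs hz₀)).1
  -- F2: the analytic untwisted normal form on an open `U ∋ y₀` of the slice `t`
  obtain ⟨U, hUo, hy₀U, -, P, Λ, k, pt, hPA, hΛA, hkA, -, hSd, hP, hndU, hL0, hL1, -, hK1, hV0, hSz⟩ :=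
    untwisted_normalForm_analytic hrate hcont hmild hdiv hpol hW hWs hnd htw hz₀
  -- regularity conversions
  have hPd : ∀ y ∈ U, ContDiffAt ℝ 2 P (v t y 2, y 2) := fun y hy => (hPA y hy).contDiffAt
  have hΛd : ∀ y ∈ U, ContDiffAt ℝ 2 Λ (v t y 2, y 2) := fun y hy => (hΛA y hy).contDiffAt
  have hkd : ∀ y ∈ U, DifferentiableAt ℝ k (v t y 2, y 2) := fun y hy => (hkA y hy).differentiableAt
  have hcd : ∀ y ∈ U, DifferentiableAt ℝ (fun q : ℝ × ℝ => fderiv ℝ P q (P q, 1)) (v t y 2, y 2) := by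
    intro y hy
    have h1 : ContDiffAt ℝ 1 (fderiv ℝ P) (v t y 2, y 2) := (hPA y hy).contDiffAt.fderiv_right (m := 1) le_top
    have h2 : ContDiffAt ℝ 1 (fun q : ℝ × ℝ => (P q, (1 : ℝ))) (v t y 2, y 2) :=
      ((hPA y hy).contDiffAt.of_le le_top).prodMk contDiffAt_const
    exact (h1.clm_apply h2).differentiableAt one_ne_zero
  -- THE DICHOTOMY (this seat's `…LrcModEntireUntwistedNormalForm`)
  rcases lrcGerm_or_stuartBranch_of_untwistedNormalForm hrate hcont hmild hdiv hpol ht (w := fun x => v t x 2) rfl hUo hy₀U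
      (c := fun q : ℝ × ℝ => fderiv ℝ P q (P q, 1)) hPd hΛd hcd hkd hSd hL0 hndU hP (fun _ _ => rfl) hK1 hV0 hSz with
    hgerm | ⟨U', hU'o, hy₀', hU'U, b, hb, hbne, hD1, hD2, hD3⟩
  · exact hgerm
  · -- the Stuart branch is empty (the K2 lead's `branch2b_false`)
    have hA : AnalyticOnNhd ℝ (v t) univ := analyticOnNhd_slice hcont (bdd_of_hasTypeITimeDecay hrate) hmild ht
    have hwA : AnalyticOnNhd ℝ (fun x => v t x 2) univ := fun x _ =>
      ((EuclideanSpace.proj (𝕜 := ℝ) (2 : Fin 3)).analyticAt _).comp (hA x (mem_univ x))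
    exact (branch2b_false hU'o hy₀' hb hwA (fun y hy => hPA y (hU'U hy)) (fun y hy => hΛA y (hU'U hy))
      (fun y hy => hP y (hU'U hy)) hbne (fun y hy => hL0 y (hU'U hy)) (fun y hy => hL1 y (hU'U hy)) hD1 hD2 hD3).elim

end Summit.NavierStokesRegularity.NavierStokesRegularity.Theorems.PoloidalWindowDoorLrcModEntireUntwistedGerm

end
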